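import Summits.Parity.BatemanHorn.Theorems.SoloInformedHooleyShiftWeights

/-!
# Blocks of moduli: the modulus weight `κ_e(h)` and Abel summation against `HooleyShiftUniform`

Informed soloist `solo-Parity-informed` (session 142), conjunct `BatemanHorn`, the `d ≥ 3` rung BELOW the parity
wall; sequel to `SoloInformedHooleyShiftWeights`.

* `modWeight e h = κ_e(h) = 1/(e·(e(−h/e) − 1))` for integer `h`: `|κ_e(h)| ≤ 1/(4|h|)` and
  `|κ_{e+1}(h) − κ_e(h)| ≤ 1/(|h|(e+1))` for `0 < 2|h| ≤ e` (chord `|e(−h/(e+1)) − e(−h/e)| ≤ 2π|h|/(e(e+1))` and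
  Jordan's inequality) — the modulus weight has variation `≪ 1/|h|` over any dyadic block;
* `norm_sum_Ioc_hooleySumShift_le_of_uniform`: `HooleyShiftUniform`'s dyadic bound extends to every range
  `(E₀, t]` with `t ≤ 2^J E₀` at the cost of the factor `J` (dyadic induction);
* `norm_sum_Ioc_mul_le_abel'`: Abel summation with the vanishing first partial sum dropped, so the weight is only
  evaluated at moduli `> E₀`.
-/

namespace Summit.Parity.BatemanHorn.Theorems

open Finset Polynomial Filter Topology
open Literature.NumberTheory.Sieve (polyRootCountMod)

/-! ### The modulus weight for integer frequencies -/

/-- `κ_e(h) = 1/(e·(e(−h/e) − 1))`. [this work] -/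
noncomputable def modWeight (e : ℕ) (h : ℤ) : ℂ :=
  1 / ((e : ℂ) * (eAdd e (-h) - 1))

/-- `trilinearTerm = κ_e(h) · bracket`. [this work] -/
theorem trilinearTerm_eq_modWeight_mul (g : ℤ[X]) (Δ : ℝ) (x e : ℕ) (h : ℤ) :
    trilinearTerm g Δ x e h = modWeight e h
      * ((locWeight g Δ e x : ℂ) * hooleySumShift g e h ((x : ℤ) + 1)
          - (locWeight g Δ e 1 : ℂ) * hooleySumShift g e h 1
          - ∑ m ∈ Ico 1 x, ((locWeight g Δ e (m + 1) - locWeight g Δ e m : ℝ) : ℂ)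
              * hooleySumShift g e h ((m : ℤ) + 1)) := rfl

/-- **`|κ_e(h)| ≤ 1/(4|h|)`** for `h ≠ 0`, `2|h| ≤ e`. [this work] -/
theorem norm_modWeight_le {e : ℕ} {h : ℤ} (h0 : h ≠ 0) (h2 : 2 * |h| ≤ (e : ℤ)) :
    ‖modWeight e h‖ ≤ 1 / (4 * |(h : ℝ)|) := by
  obtain ⟨n, hn | hn⟩ := Int.eq_nat_or_neg h
  · subst hn
    have hn0 : 0 < n := by omega
    rw [Nat.abs_cast] at h2
    have h1 := norm_modulusWeight_le_of_two_mul_le hn0 (by omega : 2 * n ≤ e)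
    rw [Int.cast_natCast, Nat.abs_cast]
    exact h1
  · subst hn
    have hn0 : 0 < n := by omega
    have habs : |(-(n : ℤ))| = n := by rw [abs_neg, Nat.abs_cast]
    rw [habs] at h2
    have h1 := norm_modulusWeight_neg_le_of_two_mul_le hn0 (by omega : 2 * n ≤ e)
    rw [Int.cast_neg, Int.cast_natCast, abs_neg, Nat.abs_cast]
    exact h1

/-- `e ∤ h` for `0 < 2|h| ≤ e`, so `e(−h/e) ≠ 1`. [folklore] -/
theorem eAdd_neg_ne_one_of_two_mul_abs_le {e : ℕ} {h : ℤ} (h0 : h ≠ 0) (h2 : 2 * |h| ≤ (e : ℤ)) :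
    eAdd e (-h) ≠ 1 := by
  have he : e ≠ 0 := by
    intro he; subst he
    have := abs_pos.mpr h0
    push_cast at h2; omega
  rw [Ne, eAdd_eq_one_iff he]
  intro hdvd
  rw [dvd_neg] at hdvd
  have h1 : (e : ℤ) ≤ |h| := Int.le_of_dvd (abs_pos.mpr h0) ((dvd_abs _ _).mpr hdvd)
  have h3 := abs_pos.mpr h0
  omega

/-- `‖1/(e(−h/e) − 1)‖ ≤ e/(4|h|)` for `h ≠ 0`, `2|h| ≤ e`. [this work] -/
theorem norm_inv_eAdd_sub_one_le {e : ℕ} {h : ℤ} (h0 : h ≠ 0) (h2 : 2 * |h| ≤ (e : ℤ)) :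
    ‖1 / (eAdd e (-h) - 1)‖ ≤ (e : ℝ) / (4 * |(h : ℝ)|) := by
  have he : (e : ℂ) ≠ 0 := by
    have : e ≠ 0 := by
      intro he; subst he
      have := abs_pos.mpr h0
      push_cast at h2; omega
    exact_mod_cast this
  have h1 := norm_modWeight_le h0 h2
  have heq : 1 / (eAdd e (-h) - 1) = (e : ℂ) * modWeight e h := by
    unfold modWeight
    field_simp
  rw [heq, norm_mul, Complex.norm_natCast]
  calc (e : ℝ) * ‖modWeight e h‖ ≤ (e : ℝ) * (1 / (4 * |(h : ℝ)|)) :=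
        mul_le_mul_of_nonneg_left h1 (Nat.cast_nonneg _)
    _ = (e : ℝ) / (4 * |(h : ℝ)|) := by ring

/-- **Chord bound**: `|e(−h/(e+1)) − e(−h/e)| ≤ 2π|h|/(e(e+1))` (`e ≥ 1`). [folklore] -/
theorem norm_eAdd_succ_sub_eAdd_le {e : ℕ} (he : 1 ≤ e) (h : ℤ) :
    ‖eAdd (e + 1) (-h) - eAdd e (-h)‖ ≤ 2 * Real.pi * |(h : ℝ)| / ((e : ℝ) * ((e : ℝ) + 1)) := by
  have he0 : (e : ℝ) ≠ 0 := by exact_mod_cast (by omega : e ≠ 0)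
  have he1 : (e : ℝ) + 1 ≠ 0 := by positivity
  set θ : ℝ := 2 * Real.pi * h / ((e : ℝ) * ((e : ℝ) + 1)) with hθ
  have hfac : eAdd (e + 1) (-h) = eAdd e (-h) * Complex.exp (Complex.I * θ) := by
    rw [eAdd, eAdd, ← Complex.exp_add]
    congr 1
    have he0' : (e : ℂ) ≠ 0 := by exact_mod_cast (by omega : e ≠ 0)
    have he1' : ((e + 1 : ℕ) : ℂ) ≠ 0 := by exact_mod_cast (by omega : e + 1 ≠ 0)
    rw [hθ]
    push_cast
    field_simp
    ring
  rw [hfac, ← mul_sub_one, norm_mul, norm_eAdd, one_mul]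
  refine (Real.norm_exp_I_mul_ofReal_sub_one_le).trans ?_
  rw [hθ, Real.norm_eq_abs, abs_div, abs_mul, abs_mul, abs_of_pos (by norm_num : (0 : ℝ) < 2),
    abs_of_pos Real.pi_pos, abs_of_pos (by positivity : (0 : ℝ) < (e : ℝ) * ((e : ℝ) + 1))]

/-- **`|κ_{e+1}(h) − κ_e(h)| ≤ 1/(|h|(e+1))`** for `h ≠ 0`, `2|h| ≤ e`. [this work] -/
theorem norm_modWeight_succ_sub_le {e : ℕ} {h : ℤ} (h0 : h ≠ 0) (h2 : 2 * |h| ≤ (e : ℤ)) :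
    ‖modWeight (e + 1) h - modWeight e h‖ ≤ 1 / (|(h : ℝ)| * ((e : ℝ) + 1)) := by
  have habs : (0 : ℝ) < |(h : ℝ)| := abs_pos.mpr (by exact_mod_cast h0)
  have he1 : 1 ≤ e := by have := abs_pos.mpr h0; omega
  have he0 : (0 : ℝ) < e := by exact_mod_cast he1
  have h2' : 2 * |h| ≤ ((e + 1 : ℕ) : ℤ) := by push_cast; omega
  set z : ℂ := eAdd e (-h) with hz
  set z' : ℂ := eAdd (e + 1) (-h) with hz'
  have hz1 : z - 1 ≠ 0 := sub_ne_zero.mpr (eAdd_neg_ne_one_of_two_mul_abs_le h0 h2)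
  have hz'1 : z' - 1 ≠ 0 := sub_ne_zero.mpr (eAdd_neg_ne_one_of_two_mul_abs_le h0 h2')
  have heC : (e : ℂ) ≠ 0 := by exact_mod_cast (by omega : e ≠ 0)
  have he1C : ((e + 1 : ℕ) : ℂ) ≠ 0 := by exact_mod_cast (by omega : e + 1 ≠ 0)
  -- decomposition `κ' − κ = A + B`
  have hdec : modWeight (e + 1) h - modWeight e h
      = (1 / ((e + 1 : ℕ) : ℂ)) * ((z - z') / ((z' - 1) * (z - 1)))
        + (1 / (z - 1)) * (1 / ((e + 1 : ℕ) : ℂ) - 1 / (e : ℂ)) := by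
    unfold modWeight
    rw [← hz, ← hz']
    field_simp
    ring
  rw [hdec]
  have hA : ‖(1 / ((e + 1 : ℕ) : ℂ)) * ((z - z') / ((z' - 1) * (z - 1)))‖
      ≤ Real.pi / (8 * (|(h : ℝ)| * ((e : ℝ) + 1))) := by
    rw [norm_mul, norm_div, norm_div, norm_mul, norm_one, Complex.norm_natCast]
    have h1 : ‖z - z'‖ ≤ 2 * Real.pi * |(h : ℝ)| / ((e : ℝ) * ((e : ℝ) + 1)) := by
      rw [norm_sub_rev]; exact norm_eAdd_succ_sub_eAdd_le he1 h
    have h3 : ‖z' - 1‖⁻¹ ≤ ((e : ℝ) + 1) / (4 * |(h : ℝ)|) := by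
      have := norm_inv_eAdd_sub_one_le h0 h2'
      rw [norm_div, norm_one, ← hz'] at this
      push_cast at this
      rwa [one_div] at this
    have h4 : ‖z - 1‖⁻¹ ≤ (e : ℝ) / (4 * |(h : ℝ)|) := by
      have := norm_inv_eAdd_sub_one_le h0 h2
      rw [norm_div, norm_one, ← hz] at this
      rwa [one_div] at this
    have hzz : 0 < ‖z' - 1‖ * ‖z - 1‖ := mul_pos (norm_pos_iff.mpr hz'1) (norm_pos_iff.mpr hz1)
    push_cast
    rw [div_eq_mul_inv ‖z - z'‖, mul_inv]
    calc 1 / ((e : ℝ) + 1) * (‖z - z'‖ * (‖z' - 1‖⁻¹ * ‖z - 1‖⁻¹))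
        ≤ 1 / ((e : ℝ) + 1) * ((2 * Real.pi * |(h : ℝ)| / ((e : ℝ) * ((e : ℝ) + 1)))
            * (((e : ℝ) + 1) / (4 * |(h : ℝ)|) * ((e : ℝ) / (4 * |(h : ℝ)|)))) := by
          refine mul_le_mul_of_nonneg_left ?_ (by positivity)
          exact mul_le_mul h1 (mul_le_mul h3 h4 (by positivity) (by positivity)) (by positivity)
            (by positivity)
      _ = Real.pi / (8 * (|(h : ℝ)| * ((e : ℝ) + 1))) := by
          field_simp
          ring
  have hB : ‖(1 / (z - 1)) * (1 / ((e + 1 : ℕ) : ℂ) - 1 / (e : ℂ))‖ ≤ 1 / (4 * (|(h : ℝ)| * ((e : ℝ) + 1))) := by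
    rw [norm_mul]
    have h4 := norm_inv_eAdd_sub_one_le h0 h2
    rw [← hz] at h4
    have h5 : ‖1 / ((e + 1 : ℕ) : ℂ) - 1 / (e : ℂ)‖ = 1 / ((e : ℝ) * ((e : ℝ) + 1)) := by
      have : (1 / ((e + 1 : ℕ) : ℂ) - 1 / (e : ℂ)) = ((-(1 / ((e : ℝ) * ((e : ℝ) + 1))) : ℝ) : ℂ) := by
        push_cast
        field_simp
        ring
      rw [this, Complex.norm_real, Real.norm_eq_abs, abs_neg, abs_of_pos (by positivity)]
    rw [h5]
    calc ‖1 / (z - 1)‖ * (1 / ((e : ℝ) * ((e : ℝ) + 1)))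
        ≤ (e : ℝ) / (4 * |(h : ℝ)|) * (1 / ((e : ℝ) * ((e : ℝ) + 1))) :=
          mul_le_mul_of_nonneg_right h4 (by positivity)
      _ = 1 / (4 * (|(h : ℝ)| * ((e : ℝ) + 1))) := by field_simp
  refine (norm_add_le _ _).trans ((add_le_add hA hB).trans ?_)
  rw [div_add_div _ _ (by positivity) (by positivity), div_le_div_iff₀ (by positivity) (by positivity)]
  have hpi := Real.pi_le_four
  have hpos : 0 < |(h : ℝ)| * ((e : ℝ) + 1) := by positivity
  nlinarith [hpos, mul_pos hpos hpos]

/-! ### Abel summation, refined, and the dyadic extension of the hypothesis -/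

/-- **Abel summation inequality, refined**: the weight is only evaluated on `(E, E']`:
`‖∑_{E<e≤E'} W(e)s(e)‖ ≤ (‖W(E')‖ + ∑_{E<e<E'} ‖W(e+1) − W(e)‖)·M` whenever `‖∑_{E<e≤t} s(e)‖ ≤ M` on `[E, E']`.
[folklore] -/
theorem norm_sum_Ioc_mul_le_abel' (W s : ℕ → ℂ) {E E' : ℕ} (hEE' : E ≤ E') {M : ℝ}
    (hM : ∀ t ∈ Icc E E', ‖∑ e ∈ Ioc E t, s e‖ ≤ M) :
    ‖∑ e ∈ Ioc E E', W e * s e‖ ≤ (‖W E'‖ + ∑ e ∈ Ioo E E', ‖W (e + 1) - W e‖) * M := by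
  have hM0 : 0 ≤ M := le_trans (norm_nonneg _) (hM E (mem_Icc.mpr ⟨le_rfl, hEE'⟩))
  rcases eq_or_lt_of_le hEE' with heq | hlt
  · subst heq
    simp only [Ioc_self, sum_empty, norm_zero]
    positivity
  rw [sum_Ioc_mul_eq_abel W s hEE', add_mul, sum_mul]
  have hsplit : ∑ e ∈ Ico E E', (W (e + 1) - W e) * ∑ i ∈ Ioc E e, s i
      = ∑ e ∈ Ioo E E', (W (e + 1) - W e) * ∑ i ∈ Ioc E e, s i := by
    have hIco : Ico E E' = insert E (Ioo E E') := by
      ext e; simp only [mem_Ico, mem_insert, mem_Ioo]; omega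
    rw [hIco, sum_insert (by simp), Ioc_self, sum_empty, mul_zero, zero_add]
  rw [hsplit]
  refine (norm_sub_le _ _).trans (add_le_add ?_ ?_)
  · rw [norm_mul]
    exact mul_le_mul_of_nonneg_left (hM E' (mem_Icc.mpr ⟨hEE', le_rfl⟩)) (norm_nonneg _)
  · refine (norm_sum_le _ _).trans (sum_le_sum fun e he => ?_)
    rw [mem_Ioo] at he
    rw [norm_mul]
    exact mul_le_mul_of_nonneg_left (hM e (mem_Icc.mpr ⟨he.1.le, he.2.le⟩)) (norm_nonneg _)

/-- **Dyadic extension of `HooleyShiftUniform`**: the block bound `C·E^{1−η}` on `(E, E'] ⊆ (E, 2E]` gives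
`‖∑_{E₀<e≤t} S^{(b)}_g(h; e)‖ ≤ J·C·t^{1−η}` on every range with `t ≤ 2^J E₀` (`η ≤ 1`, `C ≥ 0`, `|h| ≤ E₀`,
`0 ≤ b ≤ 2E₀`). [this work] -/
theorem norm_sum_Ioc_hooleySumShift_le_of_uniform {g : ℤ[X]} {η C : ℝ} (hη : η ≤ 1) (hC0 : 0 ≤ C)
    (hC : ∀ (h b : ℤ) (E E' : ℕ), h ≠ 0 → 1 ≤ E → E ≤ E' → E' ≤ 2 * E → |h| ≤ E → 0 ≤ b → b ≤ 2 * E →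
      ‖∑ e ∈ Ioc E E', hooleySumShift g e h b‖ ≤ C * (E : ℝ) ^ (1 - η))
    (J : ℕ) : ∀ (E₀ t : ℕ) (h b : ℤ), 1 ≤ E₀ → t ≤ 2 ^ J * E₀ → h ≠ 0 → |h| ≤ E₀ → 0 ≤ b → b ≤ 2 * E₀ →
      ‖∑ e ∈ Ioc E₀ t, hooleySumShift g e h b‖ ≤ J * C * (t : ℝ) ^ (1 - η) := by
  induction J with
  | zero =>
      intro E₀ t h b _ ht _ _ _ _
      rw [pow_zero, one_mul] at ht
      rw [Ioc_eq_empty (by omega), sum_empty, norm_zero, Nat.cast_zero, zero_mul, zero_mul]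
  | succ J ih =>
      intro E₀ t h b hE₀ ht hh hhE hb hbE
      rcases lt_or_ge t E₀ with htE | htE
      · rw [Ioc_eq_empty (by omega), sum_empty, norm_zero]; positivity
      have ht0 : (0 : ℝ) < t := by exact_mod_cast (by omega : 0 < t)
      have hpow : (E₀ : ℝ) ^ (1 - η) ≤ (t : ℝ) ^ (1 - η) :=
        Real.rpow_le_rpow (Nat.cast_nonneg _) (by exact_mod_cast htE) (by linarith)
      -- split at `min t (2E₀)`
      set t₁ : ℕ := min t (2 * E₀) with ht₁
      have h1 : E₀ ≤ t₁ := by omega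
      have h2 : t₁ ≤ t := min_le_left _ _
      rw [← sum_Ioc_consecutive _ h1 h2]
      refine (norm_add_le _ _).trans ?_
      have hfirst : ‖∑ e ∈ Ioc E₀ t₁, hooleySumShift g e h b‖ ≤ C * (t : ℝ) ^ (1 - η) :=
        (hC h b E₀ t₁ hh hE₀ h1 (min_le_right _ _) hhE hb hbE).trans (mul_le_mul_of_nonneg_left hpow hC0)
      have hsecond : ‖∑ e ∈ Ioc t₁ t, hooleySumShift g e h b‖ ≤ J * C * (t : ℝ) ^ (1 - η) := by
        rcases le_or_gt t (2 * E₀) with hle | hgt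
        · have : t₁ = t := by omega
          rw [this, Ioc_self, sum_empty, norm_zero]; positivity
        · have : t₁ = 2 * E₀ := by omega
          rw [this]
          refine ih (2 * E₀) t h b (by omega) ?_ hh (by omega) hb (by omega)
          rw [pow_succ] at ht
          linarith
      push_cast
      linarith

/-! ### The block estimate -/

/-- `∑_{E₀<e<E₁} 1/(e+1) ≤ 1 + log E₁`. [folklore] -/
theorem sum_Ioo_one_div_succ_le (E₀ E₁ : ℕ) :
    ∑ e ∈ Ioo E₀ E₁, 1 / ((e : ℝ) + 1) ≤ 1 + Real.log E₁ := by
  have h1 : ∑ e ∈ Ioo E₀ E₁, 1 / ((e : ℝ) + 1) ≤ ∑ e ∈ range E₁, 1 / ((e : ℝ) + 1) := by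
    refine sum_le_sum_of_subset_of_nonneg (fun e he => ?_) fun _ _ _ => by positivity
    rw [mem_Ioo] at he
    exact mem_range.mpr he.2
  have h2 : ∑ e ∈ range E₁, 1 / ((e : ℝ) + 1) = (harmonic E₁ : ℝ) := by
    rw [harmonic]
    push_cast
    exact sum_congr rfl fun e _ => by rw [one_div]
  rw [h2] at h1
  exact h1.trans (harmonic_le_one_add_log E₁)

/-- **THE BLOCK ESTIMATE.**  Under the dyadic hypothesis with constant `C ≥ 0` and exponent `η ≤ 1`: for
`g(m), g(m+1) ≠ 0`, `Δ > 0`, a frequency `h ≠ 0`, a range of moduli `(E₀, E₁]` with `E₀ ≥ 1`, `2|h| ≤ E₀ + 1`, and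
two shifts `0 ≤ b₁, b₂ ≤ 2E₀`,
`‖∑_{E₀<e≤E₁} κ_e(h)·Δa_e(m)·(S^{(b₁)}_g(h;e) − S^{(b₂)}_g(h;e))‖ ≤ (δ_m/|h|)·(2 + log E₁)·2(⌊log₂E₁⌋+1)·C·E₁^{1−η}`,
`δ_m = |log|g(m+1)| − log|g(m)||/(4Δ)`: Abel summation in `e` (weight variation `≤ (δ_m/|h|)(2 + log E₁)` by
`norm_modWeight_le`, `norm_modWeight_succ_sub_le`, `sum_abs_locWeight_sub_diff_le`) against the dyadic extension
of the hypothesis. [this work] -/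
theorem norm_block_le {g : ℤ[X]} {η C : ℝ} (hη : η ≤ 1) (hC0 : 0 ≤ C)
    (hC : ∀ (h b : ℤ) (E E' : ℕ), h ≠ 0 → 1 ≤ E → E ≤ E' → E' ≤ 2 * E → |h| ≤ E → 0 ≤ b → b ≤ 2 * E →
      ‖∑ e ∈ Ioc E E', hooleySumShift g e h b‖ ≤ C * (E : ℝ) ^ (1 - η))
    {Δ : ℝ} (hΔ : 0 < Δ) {m : ℕ} (hm : g.eval (m : ℤ) ≠ 0) (hm1 : g.eval ((m + 1 : ℕ) : ℤ) ≠ 0)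
    {h : ℤ} (h0 : h ≠ 0) {E₀ E₁ : ℕ} (hE₀ : 1 ≤ E₀) (h2 : 2 * |h| ≤ (E₀ : ℤ) + 1) (hE : E₀ ≤ E₁)
    {b₁ b₂ : ℤ} (hb₁ : 0 ≤ b₁) (hb₁' : b₁ ≤ 2 * E₀) (hb₂ : 0 ≤ b₂) (hb₂' : b₂ ≤ 2 * E₀) :
    ‖∑ e ∈ Ioc E₀ E₁, modWeight e h * ((locWeight g Δ e (m + 1) - locWeight g Δ e m : ℝ) : ℂ)
        * (hooleySumShift g e h b₁ - hooleySumShift g e h b₂)‖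
      ≤ (|Real.log ((g.eval ((m + 1 : ℕ) : ℤ)).natAbs : ℝ) - Real.log ((g.eval (m : ℤ)).natAbs : ℝ)| / (4 * Δ)
          / |(h : ℝ)|) * (2 + Real.log E₁)
        * (2 * ((Nat.log 2 E₁ + 1 : ℕ) : ℝ) * C * (E₁ : ℝ) ^ (1 - η)) := by
  set δ : ℝ := |Real.log ((g.eval ((m + 1 : ℕ) : ℤ)).natAbs : ℝ) - Real.log ((g.eval (m : ℤ)).natAbs : ℝ)|
    / (4 * Δ) with hδ
  have hδ0 : 0 ≤ δ := by positivity
  have habs : (0 : ℝ) < |(h : ℝ)| := abs_pos.mpr (by exact_mod_cast h0)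
  have hE₁1 : (1 : ℝ) ≤ E₁ := by exact_mod_cast hE₀.trans hE
  have hlogE₁ : 0 ≤ Real.log (E₁ : ℝ) := Real.log_nonneg hE₁1
  set J : ℕ := Nat.log 2 E₁ + 1 with hJ
  set M : ℝ := 2 * (J : ℝ) * C * (E₁ : ℝ) ^ (1 - η) with hM
  have hpow0 : 0 ≤ (E₁ : ℝ) ^ (1 - η) := Real.rpow_nonneg (Nat.cast_nonneg _) _
  have hM0 : 0 ≤ M := by positivity
  rcases eq_or_lt_of_le hE with heq | hlt
  · subst heq
    rw [Ioc_self, sum_empty, norm_zero]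
    positivity
  -- the weight and the signal
  set c : ℕ → ℝ := fun e => locWeight g Δ e (m + 1) - locWeight g Δ e m with hc
  set W : ℕ → ℂ := fun e => modWeight e h * ((c e : ℝ) : ℂ) with hW
  set s : ℕ → ℂ := fun e => hooleySumShift g e h b₁ - hooleySumShift g e h b₂ with hs
  have hsum : ∑ e ∈ Ioc E₀ E₁, modWeight e h * ((locWeight g Δ e (m + 1) - locWeight g Δ e m : ℝ) : ℂ)
      * (hooleySumShift g e h b₁ - hooleySumShift g e h b₂) = ∑ e ∈ Ioc E₀ E₁, W e * s e := rfl
  rw [hsum]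
  -- partial sums of the signal
  have hdy := norm_sum_Ioc_hooleySumShift_le_of_uniform hη hC0 hC J
  have hJpow : E₁ < 2 ^ J := Nat.lt_pow_succ_log_self one_lt_two E₁
  have hsig : ∀ t ∈ Icc E₀ E₁, ‖∑ e ∈ Ioc E₀ t, s e‖ ≤ M := by
    intro t ht
    rw [mem_Icc] at ht
    have htJ : t ≤ 2 ^ J * E₀ := by nlinarith
    have hhE : |h| ≤ E₀ := by omega
    have h₁ := hdy E₀ t h b₁ hE₀ htJ h0 hhE hb₁ hb₁'
    have h₂ := hdy E₀ t h b₂ hE₀ htJ h0 hhE hb₂ hb₂'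
    have htpow : (t : ℝ) ^ (1 - η) ≤ (E₁ : ℝ) ^ (1 - η) :=
      Real.rpow_le_rpow (Nat.cast_nonneg _) (by exact_mod_cast ht.2) (by linarith)
    have hJC : 0 ≤ (J : ℝ) * C := by positivity
    rw [hs, sum_sub_distrib]
    refine (norm_sub_le _ _).trans ?_
    have := mul_le_mul_of_nonneg_left htpow hJC
    rw [hM]
    linarith
  -- sizes of the weight
  have hc_le : ∀ e, |c e| ≤ δ := fun e => abs_locWeight_sub_le g hΔ e hm hm1
  have hW_le : ∀ e : ℕ, 2 * |h| ≤ (e : ℤ) → ‖W e‖ ≤ 1 / (4 * |(h : ℝ)|) * δ := by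
    intro e he
    rw [hW]; dsimp only
    rw [norm_mul, Complex.norm_real, Real.norm_eq_abs]
    exact mul_le_mul (norm_modWeight_le h0 he) (hc_le e) (abs_nonneg _) (by positivity)
  have hWdiff : ∀ e : ℕ, 2 * |h| ≤ (e : ℤ) →
      ‖W (e + 1) - W e‖ ≤ 1 / (4 * |(h : ℝ)|) * |c (e + 1) - c e| + δ * (1 / (|(h : ℝ)| * ((e : ℝ) + 1))) := by
    intro e he
    have he' : 2 * |h| ≤ ((e + 1 : ℕ) : ℤ) := by push_cast; omega
    have hsplit : W (e + 1) - W e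
        = modWeight (e + 1) h * (((c (e + 1) - c e : ℝ)) : ℂ) + (modWeight (e + 1) h - modWeight e h) * ((c e : ℝ) : ℂ) := by
      rw [hW]; dsimp only; push_cast; ring
    rw [hsplit]
    refine (norm_add_le _ _).trans (add_le_add ?_ ?_)
    · rw [norm_mul, Complex.norm_real, Real.norm_eq_abs]
      exact mul_le_mul (norm_modWeight_le h0 he') le_rfl (abs_nonneg _) (by positivity)
    · rw [norm_mul, Complex.norm_real, Real.norm_eq_abs, mul_comm]
      exact mul_le_mul (hc_le e) (norm_modWeight_succ_sub_le h0 he) (norm_nonneg _) hδ0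
  -- total variation of the weight over `(E₀, E₁)`
  have hTV : ∑ e ∈ Ioo E₀ E₁, ‖W (e + 1) - W e‖ ≤ 1 / (4 * |(h : ℝ)|) * (3 * δ) + δ * (1 + Real.log E₁) / |(h : ℝ)| := by
    have hIoo : Ioo E₀ E₁ = Ico (E₀ + 1) E₁ := by ext e; simp only [mem_Ioo, mem_Ico]; omega
    calc ∑ e ∈ Ioo E₀ E₁, ‖W (e + 1) - W e‖
        ≤ ∑ e ∈ Ioo E₀ E₁, (1 / (4 * |(h : ℝ)|) * |c (e + 1) - c e| + δ * (1 / (|(h : ℝ)| * ((e : ℝ) + 1)))) := by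
          refine sum_le_sum fun e he => hWdiff e ?_
          rw [mem_Ioo] at he
          omega
      _ = 1 / (4 * |(h : ℝ)|) * ∑ e ∈ Ico (E₀ + 1) E₁, |c (e + 1) - c e|
            + δ / |(h : ℝ)| * ∑ e ∈ Ioo E₀ E₁, 1 / ((e : ℝ) + 1) := by
          rw [sum_add_distrib, ← mul_sum, ← hIoo, mul_sum, mul_sum]
          congr 1
          exact sum_congr rfl fun e _ => by field_simp
      _ ≤ 1 / (4 * |(h : ℝ)|) * (3 * δ) + δ / |(h : ℝ)| * (1 + Real.log E₁) := by
          refine add_le_add (mul_le_mul_of_nonneg_left ?_ (by positivity))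
            (mul_le_mul_of_nonneg_left (sum_Ioo_one_div_succ_le E₀ E₁) (by positivity))
          have := sum_abs_locWeight_sub_diff_le g hΔ hm hm1 (a := E₀ + 1) (b := E₁) (by omega)
          exact this
      _ = _ := by ring
  -- Abel
  have hAbel := norm_sum_Ioc_mul_le_abel' W s hE hsig
  refine hAbel.trans ?_
  have hWE₁ := hW_le E₁ (by omega)
  have hfac : ‖W E₁‖ + ∑ e ∈ Ioo E₀ E₁, ‖W (e + 1) - W e‖ ≤ δ / |(h : ℝ)| * (2 + Real.log E₁) := by
    have := add_le_add hWE₁ hTV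
    refine this.trans (le_of_eq ?_)
    field_simp
    ring
  exact mul_le_mul_of_nonneg_right hfac hM0

end Summit.Parity.BatemanHorn.Theorems
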